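import Summits.KontsevichZagierPeriods.KontsevichZagierPeriods.Theses.KinematicFormulas
import Literature.NumberTheory.Transcendental.KZProductIdeal
import Literature.NumberTheory.Transcendental.KZLogCalculusProofs

/-!
# Crux `KinematicPlaneConvexR` (stmt-KontsevichZagierPeriods-10736) — skeleton line `birth`

Route: route-KontsevichZagierPeriods-KinematicFormulas (the PLANE ENGINE, crux rank 2).

The crux says: for all NON-EMPTY compact convex ℚ-semialgebraic `K, L ⊂ ℝ²`, Blaschke's principal
kinematic relator in the tan-half-angle chart of `SE(2)`,
`[Inc(K,L), 2/(1+t²)] − [ℝ_t × K, 2/(1+t²)] − [ℝ_t × L, 2/(1+t²)] − [LineHit K × LineHit L, 4/((1+t²)(1+t′²))]`,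
lies in `KZ.relations` (values: `(2πA_K + 2πA_L + L_K L_L) − 2πA_K − 2πA_L − L_K L_L = 0`).

Skeleton = the classical proof's own joints (Minkowski/Steiner/Cauchy–Crofton), with the surface-area
measure `dS_K` (which has ATOMS at the flat edges of a semialgebraic `K` — the crux's named risk)
SMEARED into a top-dimensional Lebesgue integral by the STEINER SHELLS
`Shell_ε(K) = {y ∉ K | dist(y, K) ≤ ε}`: for every continuous `f` on `S¹` and every non-empty compact
convex `K ⊂ ℝ²` (point, segment or body alike)
`∫_{Shell_ε K} f(n_K(y)) dy = ε ∫ f dS_K + (ε²/2) ∫_{S¹} f`, hence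
`4·∫_{Shell_{1/2} K} f∘n_K − ∫_{Shell_1 K} f∘n_K = ∫ f dS_K` EXACTLY and UNIFORMLY (integer coefficients,
no limits). The intermediate representations are the PRODUCTS
`Y_ε = [Shell_ε(K) × LineHit L, 2/(1+t²)]` (value `(ε L_K + π ε²)·L_L`), and the crux splits as
* `stub_shellReps`            — ADMISSIBILITY: the shells `[Shell_{1/2} K, 1]`, `[Shell_1 K, 1]` and the
                                 hitting set `[LineHit K, 2/(1+t²)]` ARE integral representations
                                 (ℚ-semialgebraic by Tarski–Seidenberg; bounded, resp. `2/(1+t²)`-dominated);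
* `stub_steinerCrofton`       — STEINER + CAUCHY–CROFTON INSIDE THE RULES, one body, in the plane:
                                 `4·[Shell_{1/2} K, 1] − [Shell_1 K, 1] − [LineHit K, 2/(1+t²)] ∈ KZ.relations`
                                 (value `4(L_K/2 + π/4) − (L_K + π) − L_K = 0`);
* `stub_kinematicShellTransfer` — THE KINEMATIC CORE: `[Inc] − [ℝ×K] − [ℝ×L] − 4·[Y_{1/2}] + [Y_1] ∈ KZ.relations`
                                 (value `L_K L_L − (2L_K + π − L_K − π) L_L = 0`): fibrewise in the rotation
                                 `t` the Minkowski mixed-area identity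
                                 `A(K ⊕ M_t) − A(K) − A(M_t) = 2A(K, M_t) = 4∫_{Shell_{1/2}K} h_{M_t}∘n_K − ∫_{Shell_1 K} h_{M_t}∘n_K`
                                 (`M_t = −R_φ L`), then the torus shear `φ ↦ φ − θ(n_K(y))` (a Möbius change of
                                 variables in `t` with coefficients semialgebraic in `y`, Jacobian absorbed by
                                 `2/(1+t²)`) decouples `y` from `t`, and Cauchy's formula for `L`
                                 (`[ℝ_t, 2h_L(n_t)/(1+t²)] ~ [LineHit L, 2/(1+t²)]`, by Newton–Leibniz in `p` and
                                 the HALF-TURN splitting `φ ∈ [0,π) ⊔ [π,2π)` — never "divide by 2").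
`KinematicPlaneConvexR_of_stubs` (arrow form: stub₁-sig → stub₂-sig → stub₃-sig → crux unfolded verbatim) re-assembles them
with REAL glue from the tree, and `KinematicPlaneConvexR_of : KinematicPlaneConvexR` feeds the three stubs in BY NAME: the right-ideal property of
`KZ.relations` (`KZ.mul_mem_relations_right_holds`, multiplying the plane relation by `[LineHit L]`),
`KZ.of_mul_of` / `IntegralRep.prod` (the products `Y_ε` and `LineHit K × LineHit L`), and the congruence
`KZ.of_sub_of_mem_relations_of_eqOn` (identifying `[LineHit K].prod [LineHit L]` with the crux's `r₃`).
No stub gives the crux or the summit on its own (each is one joint of a three-joint chain).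

Disproof used: none on file (`ledger crux ls stmt-KontsevichZagierPeriods-10736`: no workfiles, no
Disproof.lean; `ledger negatives`: the only negative of the summit is the predecessor KinematicPlaneConvex,
stmt-5394, killed by `L = ∅` — every stub here carries `K.Nonempty` / `L.Nonempty`, and the values above
are checked on points, segments and bodies).
-/

set_option linter.dupNamespace false

namespace Summit.KontsevichZagierPeriods.KontsevichZagierPeriods.Cruxes.KinematicPlaneConvexR.Birth

open Set Literature.NumberTheory.Transcendental

/-- ADMISSIBILITY OF THE SHELL AND HITTING REPRESENTATIONS: for a non-empty compact convex
ℚ-semialgebraic `K ⊂ ℝ²`, the two Steiner shells `Shell_{1/2}(K)`, `Shell_1(K)` with integrand `1`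
and the hitting set `LineHit K = {(t, p) : p ≥ 0, ∃ q ∈ K, q·((1−t²), 2t) = (1+t²) p}` with integrand
`2/(1+t²)` are integral representations (ℚ-semialgebraic domains: one projection each, Tarski–Seidenberg;
absolute convergence: bounded domains, resp. `p` bounded by `max_K |q|` and `∫ 2/(1+t²) dt = 2π`). -/
theorem stub_shellReps :
    ∀ K : Set (Fin 2 → ℝ), Literature.ModelTheory.ExponentialFields.IsSemialgebraic ℚ K → Convex ℝ K →
      IsCompact K → K.Nonempty →
      ∃ s₁ s₂ ℓ : Literature.NumberTheory.Transcendental.KZ.IntegralRep 2,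
        s₁.domain = {y : Fin 2 → ℝ | y ∉ K ∧ ∃ k ∈ K, 4 * ((y 0 - k 0) ^ 2 + (y 1 - k 1) ^ 2) ≤ 1} ∧
        Set.EqOn s₁.integrand (fun _ => 1) s₁.domain ∧
        s₂.domain = {y : Fin 2 → ℝ | y ∉ K ∧ ∃ k ∈ K, (y 0 - k 0) ^ 2 + (y 1 - k 1) ^ 2 ≤ 1} ∧
        Set.EqOn s₂.integrand (fun _ => 1) s₂.domain ∧
        ℓ.domain = {w : Fin 2 → ℝ | 0 ≤ w 1 ∧ ∃ q ∈ K, (1 - w 0 ^ 2) * q 0 + 2 * w 0 * q 1 = (1 + w 0 ^ 2) * w 1} ∧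
        Set.EqOn ℓ.integrand (fun w => 2 / (1 + w 0 ^ 2)) ℓ.domain := by
  sorry

/-- STEINER + CAUCHY–CROFTON INSIDE THE RULES (one body, in the plane): for a non-empty compact convex
ℚ-semialgebraic `K ⊂ ℝ²`, `4·[Shell_{1/2} K, 1] − [Shell_1 K, 1] − [LineHit K, 2/(1+t²)] ∈ KZ.relations`.
Values: `A(Shell_ε K) = ε L_K + π ε²` (Steiner; `L_K` = perimeter = `2V₁`, so `2·length` for a segment,
`0` for a point) and `m(LineHit K) = ∫ ℓ_K(φ) dφ = L_K` (Cauchy–Crofton), whence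
`4(L_K/2 + π/4) − (L_K + π) − L_K = 0`. Suggested chain: stratify `∂K` (ℚ-cell decomposition) into
vertices, flat edges and strictly convex Nash arcs; on `Shell_ε` use the normal-bundle change of
variables `y = k + r·n` per stratum (sectors at vertices: `4·[sector_{1/2}] ~ [sector_1]` by the
dilation `y ↦ v + 2(y − v)`, Jacobian 4; rectangles at edges; Jacobian `ρ + r` on arcs, Newton–Leibniz
in `r` with the polynomial primitive `ρ r + r²/2`), and on `LineHit K` Newton–Leibniz in `p` followed by
the half-turn splitting `φ ∈ [0, π) ⊔ [π, 2π)` and Cauchy's projection formula per stratum. -/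
theorem stub_steinerCrofton :
    ∀ K : Set (Fin 2 → ℝ), Literature.ModelTheory.ExponentialFields.IsSemialgebraic ℚ K → Convex ℝ K →
      IsCompact K → K.Nonempty →
      ∀ (s₁ s₂ ℓ : Literature.NumberTheory.Transcendental.KZ.IntegralRep 2),
        s₁.domain = {y : Fin 2 → ℝ | y ∉ K ∧ ∃ k ∈ K, 4 * ((y 0 - k 0) ^ 2 + (y 1 - k 1) ^ 2) ≤ 1} →
        Set.EqOn s₁.integrand (fun _ => 1) s₁.domain →
        s₂.domain = {y : Fin 2 → ℝ | y ∉ K ∧ ∃ k ∈ K, (y 0 - k 0) ^ 2 + (y 1 - k 1) ^ 2 ≤ 1} →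
        Set.EqOn s₂.integrand (fun _ => 1) s₂.domain →
        ℓ.domain = {w : Fin 2 → ℝ | 0 ≤ w 1 ∧ ∃ q ∈ K, (1 - w 0 ^ 2) * q 0 + 2 * w 0 * q 1 = (1 + w 0 ^ 2) * w 1} →
        Set.EqOn ℓ.integrand (fun w => 2 / (1 + w 0 ^ 2)) ℓ.domain →
        4 • Literature.NumberTheory.Transcendental.KZ.of s₁ - Literature.NumberTheory.Transcendental.KZ.of s₂ -
            Literature.NumberTheory.Transcendental.KZ.of ℓ ∈
          Literature.NumberTheory.Transcendental.KZ.relations := by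
  sorry

/-- THE KINEMATIC CORE (Minkowski mixed area through the Steiner shells, torus shear, Cauchy for `L`):
for NON-EMPTY compact convex ℚ-semialgebraic `K, L ⊂ ℝ²`, with the crux's `r₀ = [Inc(K,L), 2/(1+t²)]`,
`r₁ = [ℝ_t × K, 2/(1+t²)]`, `r₂ = [ℝ_t × L, 2/(1+t²)]` and the shell products
`y_ε = [Shell_ε(K) × LineHit L, 2/(1+t²)]` (coordinates `z = (y₀, y₁, t, p)`; `ε = 1/2, 1`):
`[r₀] − [r₁] − [r₂] − 4·[y_{1/2}] + [y_1] ∈ KZ.relations`. Values: `L_K L_L − (4(L_K/2 + π/4) − (L_K + π))·L_L = 0`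
for every non-empty pair (points and segments included: `L = 2V₁`). Suggested chain: fibrewise in `t`,
`A(K ⊕ M_t) − A_K − A_L = 2A(K, M_t) = ∫ h_{M_t} dS_K = 4∫_{Shell_{1/2}K} h_{M_t}(n_K y) dy − ∫_{Shell_1 K} h_{M_t}(n_K y) dy`
(`M_t = −R_φ L`, `h` = support function, `n_K` = outer normal at the metric projection — semialgebraic);
then the shear `t ↦ tan((φ − θ(n_K y) + π)/2)` (Möbius in `t`, coefficients semialgebraic in `y`, the
Jacobian turns `2/(1+t²)` into `2/(1+t′²)`) makes the integrand `h_L(n_{t′})·2/(1+t′²)`, independent of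
`y`: a product `[Shell_ε K, 1]·[ℝ, 2h_L(n_t)/(1+t²)]`; finally Cauchy for `L`:
`[ℝ, 2h_L(n_t)/(1+t²)] ~ [LineHit L, 2/(1+t²)]` (Newton–Leibniz in `p`; the defect `h_L − ℓ_L` is ODD
under the half-turn, so it cancels after splitting the circle into two half-turns — no division by 2). -/
theorem stub_kinematicShellTransfer :
    ∀ K L : Set (Fin 2 → ℝ), Literature.ModelTheory.ExponentialFields.IsSemialgebraic ℚ K →
      Literature.ModelTheory.ExponentialFields.IsSemialgebraic ℚ L → Convex ℝ K → Convex ℝ L →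
      IsCompact K → IsCompact L → K.Nonempty → L.Nonempty →
      ∀ (r₀ r₁ r₂ : Literature.NumberTheory.Transcendental.KZ.IntegralRep 3)
        (y₁ y₂ : Literature.NumberTheory.Transcendental.KZ.IntegralRep 4),
        r₀.domain = {x : Fin 3 → ℝ | ∃ q ∈ L, (![((1 - x 0 ^ 2) * q 0 - 2 * x 0 * q 1) / (1 + x 0 ^ 2) + x 1,
          (2 * x 0 * q 0 + (1 - x 0 ^ 2) * q 1) / (1 + x 0 ^ 2) + x 2] : Fin 2 → ℝ) ∈ K} →
        Set.EqOn r₀.integrand (fun x => 2 / (1 + x 0 ^ 2)) r₀.domain →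
        r₁.domain = {x : Fin 3 → ℝ | (![x 1, x 2] : Fin 2 → ℝ) ∈ K} →
        Set.EqOn r₁.integrand (fun x => 2 / (1 + x 0 ^ 2)) r₁.domain →
        r₂.domain = {x : Fin 3 → ℝ | (![x 1, x 2] : Fin 2 → ℝ) ∈ L} →
        Set.EqOn r₂.integrand (fun x => 2 / (1 + x 0 ^ 2)) r₂.domain →
        y₁.domain = {z : Fin 4 → ℝ | ((![z 0, z 1] : Fin 2 → ℝ) ∉ K ∧
            ∃ k ∈ K, 4 * ((z 0 - k 0) ^ 2 + (z 1 - k 1) ^ 2) ≤ 1) ∧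
          (0 ≤ z 3 ∧ ∃ q ∈ L, (1 - z 2 ^ 2) * q 0 + 2 * z 2 * q 1 = (1 + z 2 ^ 2) * z 3)} →
        Set.EqOn y₁.integrand (fun z => 2 / (1 + z 2 ^ 2)) y₁.domain →
        y₂.domain = {z : Fin 4 → ℝ | ((![z 0, z 1] : Fin 2 → ℝ) ∉ K ∧
            ∃ k ∈ K, (z 0 - k 0) ^ 2 + (z 1 - k 1) ^ 2 ≤ 1) ∧
          (0 ≤ z 3 ∧ ∃ q ∈ L, (1 - z 2 ^ 2) * q 0 + 2 * z 2 * q 1 = (1 + z 2 ^ 2) * z 3)} →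
        Set.EqOn y₂.integrand (fun z => 2 / (1 + z 2 ^ 2)) y₂.domain →
        Literature.NumberTheory.Transcendental.KZ.of r₀ - Literature.NumberTheory.Transcendental.KZ.of r₁ -
              Literature.NumberTheory.Transcendental.KZ.of r₂ -
              4 • Literature.NumberTheory.Transcendental.KZ.of y₁ +
            Literature.NumberTheory.Transcendental.KZ.of y₂ ∈
          Literature.NumberTheory.Transcendental.KZ.relations := by
  sorry

/-- **ASSEMBLY, arrow form** (kernel-checked, no `sorry`): the three stub statements imply the crux statement
(conclusion = the crux signature UNFOLDED VERBATIM, so that exactly one theorem of this file — `KinematicPlaneConvexR_of`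
below — concludes the crux BY NAME, the shape `#h21_check_skeleton` keys on). Proof: get the shell/hitting representations of `K` and the hitting representation of `L`
(`stub_shellReps`); Steiner–Crofton for `K` (`stub_steinerCrofton`) multiplied on the right by
`[LineHit L]` is again a relation (`KZ.mul_mem_relations_right_holds`) and reads
`4·[y_{1/2}] − [y_1] − [LineHit K × LineHit L]` with `y_ε := [Shell_ε K].prod [LineHit L]`
(`KZ.of_mul_of`); these `y_ε` have exactly the domains and integrands the core stub wants
(`IntegralRep.prod_domain`, `IntegralRep.prod_integrand_eq`), and `[LineHit K].prod [LineHit L]`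
is congruent to the crux's `r₃` (`KZ.of_sub_of_mem_relations_of_eqOn`:
same domain, `2/(1+t²) · 2/(1+t′²) = 4/((1+t²)(1+t′²))` on it); add the three relations. -/
theorem KinematicPlaneConvexR_of_stubs :
    (∀ K : Set (Fin 2 → ℝ), Literature.ModelTheory.ExponentialFields.IsSemialgebraic ℚ K → Convex ℝ K →
      IsCompact K → K.Nonempty →
      ∃ s₁ s₂ ℓ : Literature.NumberTheory.Transcendental.KZ.IntegralRep 2,
        s₁.domain = {y : Fin 2 → ℝ | y ∉ K ∧ ∃ k ∈ K, 4 * ((y 0 - k 0) ^ 2 + (y 1 - k 1) ^ 2) ≤ 1} ∧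
        Set.EqOn s₁.integrand (fun _ => 1) s₁.domain ∧
        s₂.domain = {y : Fin 2 → ℝ | y ∉ K ∧ ∃ k ∈ K, (y 0 - k 0) ^ 2 + (y 1 - k 1) ^ 2 ≤ 1} ∧
        Set.EqOn s₂.integrand (fun _ => 1) s₂.domain ∧
        ℓ.domain = {w : Fin 2 → ℝ | 0 ≤ w 1 ∧ ∃ q ∈ K, (1 - w 0 ^ 2) * q 0 + 2 * w 0 * q 1 = (1 + w 0 ^ 2) * w 1} ∧
        Set.EqOn ℓ.integrand (fun w => 2 / (1 + w 0 ^ 2)) ℓ.domain) →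
    (∀ K : Set (Fin 2 → ℝ), Literature.ModelTheory.ExponentialFields.IsSemialgebraic ℚ K → Convex ℝ K →
      IsCompact K → K.Nonempty →
      ∀ (s₁ s₂ ℓ : Literature.NumberTheory.Transcendental.KZ.IntegralRep 2),
        s₁.domain = {y : Fin 2 → ℝ | y ∉ K ∧ ∃ k ∈ K, 4 * ((y 0 - k 0) ^ 2 + (y 1 - k 1) ^ 2) ≤ 1} →
        Set.EqOn s₁.integrand (fun _ => 1) s₁.domain →
        s₂.domain = {y : Fin 2 → ℝ | y ∉ K ∧ ∃ k ∈ K, (y 0 - k 0) ^ 2 + (y 1 - k 1) ^ 2 ≤ 1} →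
        Set.EqOn s₂.integrand (fun _ => 1) s₂.domain →
        ℓ.domain = {w : Fin 2 → ℝ | 0 ≤ w 1 ∧ ∃ q ∈ K, (1 - w 0 ^ 2) * q 0 + 2 * w 0 * q 1 = (1 + w 0 ^ 2) * w 1} →
        Set.EqOn ℓ.integrand (fun w => 2 / (1 + w 0 ^ 2)) ℓ.domain →
        4 • Literature.NumberTheory.Transcendental.KZ.of s₁ - Literature.NumberTheory.Transcendental.KZ.of s₂ -
            Literature.NumberTheory.Transcendental.KZ.of ℓ ∈
          Literature.NumberTheory.Transcendental.KZ.relations) →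
    (∀ K L : Set (Fin 2 → ℝ), Literature.ModelTheory.ExponentialFields.IsSemialgebraic ℚ K →
      Literature.ModelTheory.ExponentialFields.IsSemialgebraic ℚ L → Convex ℝ K → Convex ℝ L →
      IsCompact K → IsCompact L → K.Nonempty → L.Nonempty →
      ∀ (r₀ r₁ r₂ : Literature.NumberTheory.Transcendental.KZ.IntegralRep 3)
        (y₁ y₂ : Literature.NumberTheory.Transcendental.KZ.IntegralRep 4),
        r₀.domain = {x : Fin 3 → ℝ | ∃ q ∈ L, (![((1 - x 0 ^ 2) * q 0 - 2 * x 0 * q 1) / (1 + x 0 ^ 2) + x 1,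
          (2 * x 0 * q 0 + (1 - x 0 ^ 2) * q 1) / (1 + x 0 ^ 2) + x 2] : Fin 2 → ℝ) ∈ K} →
        Set.EqOn r₀.integrand (fun x => 2 / (1 + x 0 ^ 2)) r₀.domain →
        r₁.domain = {x : Fin 3 → ℝ | (![x 1, x 2] : Fin 2 → ℝ) ∈ K} →
        Set.EqOn r₁.integrand (fun x => 2 / (1 + x 0 ^ 2)) r₁.domain →
        r₂.domain = {x : Fin 3 → ℝ | (![x 1, x 2] : Fin 2 → ℝ) ∈ L} →
        Set.EqOn r₂.integrand (fun x => 2 / (1 + x 0 ^ 2)) r₂.domain →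
        y₁.domain = {z : Fin 4 → ℝ | ((![z 0, z 1] : Fin 2 → ℝ) ∉ K ∧
            ∃ k ∈ K, 4 * ((z 0 - k 0) ^ 2 + (z 1 - k 1) ^ 2) ≤ 1) ∧
          (0 ≤ z 3 ∧ ∃ q ∈ L, (1 - z 2 ^ 2) * q 0 + 2 * z 2 * q 1 = (1 + z 2 ^ 2) * z 3)} →
        Set.EqOn y₁.integrand (fun z => 2 / (1 + z 2 ^ 2)) y₁.domain →
        y₂.domain = {z : Fin 4 → ℝ | ((![z 0, z 1] : Fin 2 → ℝ) ∉ K ∧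
            ∃ k ∈ K, (z 0 - k 0) ^ 2 + (z 1 - k 1) ^ 2 ≤ 1) ∧
          (0 ≤ z 3 ∧ ∃ q ∈ L, (1 - z 2 ^ 2) * q 0 + 2 * z 2 * q 1 = (1 + z 2 ^ 2) * z 3)} →
        Set.EqOn y₂.integrand (fun z => 2 / (1 + z 2 ^ 2)) y₂.domain →
        Literature.NumberTheory.Transcendental.KZ.of r₀ - Literature.NumberTheory.Transcendental.KZ.of r₁ -
              Literature.NumberTheory.Transcendental.KZ.of r₂ -
              4 • Literature.NumberTheory.Transcendental.KZ.of y₁ +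
            Literature.NumberTheory.Transcendental.KZ.of y₂ ∈
          Literature.NumberTheory.Transcendental.KZ.relations) →
    ∀ K L : Set (Fin 2 → ℝ), Literature.ModelTheory.ExponentialFields.IsSemialgebraic ℚ K → Literature.ModelTheory.ExponentialFields.IsSemialgebraic ℚ L → Convex ℝ K → Convex ℝ L → IsCompact K → IsCompact L → K.Nonempty → L.Nonempty → ∀ (r₀ r₁ r₂ : Literature.NumberTheory.Transcendental.KZ.IntegralRep 3) (r₃ : Literature.NumberTheory.Transcendental.KZ.IntegralRep 4), r₀.domain = {x : Fin 3 → ℝ | ∃ q ∈ L, (![((1 - x 0 ^ 2) * q 0 - 2 * x 0 * q 1) / (1 + x 0 ^ 2) + x 1, (2 * x 0 * q 0 + (1 - x 0 ^ 2) * q 1) / (1 + x 0 ^ 2) + x 2] : Fin 2 → ℝ) ∈ K} → Set.EqOn r₀.integrand (fun x => 2 / (1 + x 0 ^ 2)) r₀.domain → r₁.domain = {x : Fin 3 → ℝ | (![x 1, x 2] : Fin 2 → ℝ) ∈ K} → Set.EqOn r₁.integrand (fun x => 2 / (1 + x 0 ^ 2)) r₁.domain → r₂.domain = {x : Fin 3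 → ℝ | (![x 1, x 2] : Fin 2 → ℝ) ∈ L} → Set.EqOn r₂.integrand (fun x => 2 / (1 + x 0 ^ 2)) r₂.domain → r₃.domain = {z : Fin 4 → ℝ | (0 ≤ z 1 ∧ ∃ q ∈ K, (1 - z 0 ^ 2) * q 0 + 2 * z 0 * q 1 = (1 + z 0 ^ 2) * z 1) ∧ (0 ≤ z 3 ∧ ∃ q ∈ L, (1 - z 2 ^ 2) * q 0 + 2 * z 2 * q 1 = (1 + z 2 ^ 2) * z 3)} → Set.EqOn r₃.integrand (fun z => 4 / ((1 + z 0 ^ 2) * (1 + z 2 ^ 2))) r₃.domain → Literature.NumberTheory.Transcendental.KZ.of r₀ - Literature.NumberTheory.Transcendental.KZ.of r₁ - Literature.NumberTheory.Transcendental.KZ.of r₂ - Literature.NumberTheory.Transcendental.KZ.of r₃ ∈ Literature.NumberTheory.Transcendental.KZ.relations := by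
  intro hReps hSC hCore K L hK hL hcK hcL hKc hLc hKn hLn r₀ r₁ r₂ r₃ h0d h0i h1d h1i h2d h2i h3d h3i
  -- the shell and hitting representations of `K`, the hitting representation of `L`
  obtain ⟨s₁, s₂, ℓK, hs₁d, hs₁i, hs₂d, hs₂i, hℓKd, hℓKi⟩ := hReps K hK hcK hKc hKn
  obtain ⟨_, _, ℓL, -, -, -, -, hℓLd, hℓLi⟩ := hReps L hL hcL hLc hLn
  -- Steiner + Cauchy–Crofton for `K`, in the plane …
  have hplane : 4 • KZ.of s₁ - KZ.of s₂ - KZ.of ℓK ∈ KZ.relations :=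
    hSC K hK hcK hKc hKn s₁ s₂ ℓK hs₁d hs₁i hs₂d hs₂i hℓKd hℓKi
  -- … multiplied on the right by `[LineHit L]` (right-ideal property of `relations`)
  have hprod : 4 • KZ.of (s₁.prod ℓL) - KZ.of (s₂.prod ℓL) - KZ.of (ℓK.prod ℓL) ∈ KZ.relations := by
    have h := KZ.mul_mem_relations_right_holds _ (KZ.of ℓL) hplane
    have e : (4 • KZ.of s₁ - KZ.of s₂ - KZ.of ℓK) * KZ.of ℓL =
        4 • KZ.of (s₁.prod ℓL) - KZ.of (s₂.prod ℓL) - KZ.of (ℓK.prod ℓL) := by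
      rw [sub_mul, sub_mul, smul_mul_assoc, KZ.of_mul_of, KZ.of_mul_of, KZ.of_mul_of]
    rw [← e]
    exact h
  -- coordinate bookkeeping on `Fin 4 = Fin (2 + 2)`
  have hcast : ∀ z : Fin (2 + 2) → ℝ, (fun i : Fin 2 => z (Fin.castAdd 2 i)) = ![z 0, z 1] := by
    intro z; funext i; fin_cases i <;> rfl
  have hnat : ∀ z : Fin (2 + 2) → ℝ, (fun j : Fin 2 => z (Fin.natAdd 2 j)) = ![z 2, z 3] := by
    intro z; funext j; fin_cases j <;> rfl
  -- the products `[Shell_ε K].prod [LineHit L]` are the `y_ε` of the core stub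
  have hy₁d : (s₁.prod ℓL).domain = {z : Fin 4 → ℝ | ((![z 0, z 1] : Fin 2 → ℝ) ∉ K ∧
        ∃ k ∈ K, 4 * ((z 0 - k 0) ^ 2 + (z 1 - k 1) ^ 2) ≤ 1) ∧
      (0 ≤ z 3 ∧ ∃ q ∈ L, (1 - z 2 ^ 2) * q 0 + 2 * z 2 * q 1 = (1 + z 2 ^ 2) * z 3)} := by
    ext z
    rw [KZ.IntegralRep.prod_domain, KZ.IntegralRep.mem_prodDomain, hcast z, hnat z, hs₁d, hℓLd]
    simp
  have hy₂d : (s₂.prod ℓL).domain = {z : Fin 4 → ℝ | ((![z 0, z 1] : Fin 2 → ℝ) ∉ K ∧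
        ∃ k ∈ K, (z 0 - k 0) ^ 2 + (z 1 - k 1) ^ 2 ≤ 1) ∧
      (0 ≤ z 3 ∧ ∃ q ∈ L, (1 - z 2 ^ 2) * q 0 + 2 * z 2 * q 1 = (1 + z 2 ^ 2) * z 3)} := by
    ext z
    rw [KZ.IntegralRep.prod_domain, KZ.IntegralRep.mem_prodDomain, hcast z, hnat z, hs₂d, hℓLd]
    simp
  have hy₁i : Set.EqOn (s₁.prod ℓL).integrand (fun z => 2 / (1 + z 2 ^ 2)) (s₁.prod ℓL).domain := by
    intro z hz
    rw [KZ.IntegralRep.prod_domain, KZ.IntegralRep.mem_prodDomain] at hz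
    rw [KZ.IntegralRep.prod_integrand_eq, KZ.IntegralRep.prodFun_apply, hs₁i hz.1, hℓLi hz.2, hnat z]
    simp
  have hy₂i : Set.EqOn (s₂.prod ℓL).integrand (fun z => 2 / (1 + z 2 ^ 2)) (s₂.prod ℓL).domain := by
    intro z hz
    rw [KZ.IntegralRep.prod_domain, KZ.IntegralRep.mem_prodDomain] at hz
    rw [KZ.IntegralRep.prod_integrand_eq, KZ.IntegralRep.prodFun_apply, hs₂i hz.1, hℓLi hz.2, hnat z]
    simp
  -- the kinematic core, fed with these products
  have hcore : KZ.of r₀ - KZ.of r₁ - KZ.of r₂ - 4 • KZ.of (s₁.prod ℓL) + KZ.of (s₂.prod ℓL) ∈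
      KZ.relations :=
    hCore K L hK hL hcK hcL hKc hLc hKn hLn r₀ r₁ r₂ (s₁.prod ℓL) (s₂.prod ℓL) h0d h0i h1d h1i h2d h2i
      hy₁d hy₁i hy₂d hy₂i
  -- `[LineHit K].prod [LineHit L]` is congruent to the crux's `r₃`
  have hr₃ : KZ.of (ℓK.prod ℓL) - KZ.of r₃ ∈ KZ.relations := by
    refine KZ.of_sub_of_mem_relations_of_eqOn ?_ ?_
    · rw [h3d]
      ext z
      rw [KZ.IntegralRep.prod_domain, KZ.IntegralRep.mem_prodDomain, hcast z, hnat z, hℓKd, hℓLd]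
      simp
    · intro z hz
      have hz' := hz
      rw [KZ.IntegralRep.prod_domain, KZ.IntegralRep.mem_prodDomain] at hz'
      have hz₃ : z ∈ r₃.domain := by
        rw [h3d]
        rw [hcast z, hnat z, hℓKd, hℓLd] at hz'
        simpa using hz'
      rw [KZ.IntegralRep.prod_integrand_eq, KZ.IntegralRep.prodFun_apply, hℓKi hz'.1, hℓLi hz'.2,
        h3i hz₃, hcast z, hnat z]
      simp only [Matrix.cons_val_zero]
      rw [div_mul_div_comm]
      norm_num
  -- subgroup arithmetic
  have hsum := KZ.relations.add_mem (KZ.relations.add_mem hcore hprod) hr₃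
  convert hsum using 1
  abel

/-- **The skeleton theorem**: concludes the crux `KinematicPlaneConvexR` BY NAME — the three stubs fed into
`KinematicPlaneConvexR_of_stubs`; its only `sorryAx` dependencies are `stub_shellReps`, `stub_steinerCrofton`,
`stub_kinematicShellTransfer` (the crux is a `def`, so the unfolded conclusion of `_of_stubs` is accepted by `δ`). -/
theorem KinematicPlaneConvexR_of :
    Summit.KontsevichZagierPeriods.KontsevichZagierPeriods.Theses.KinematicFormulas.KinematicPlaneConvexR :=
  KinematicPlaneConvexR_of_stubs stub_shellReps stub_steinerCrofton stub_kinematicShellTransfer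

end Summit.KontsevichZagierPeriods.KontsevichZagierPeriods.Cruxes.KinematicPlaneConvexR.Birth
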